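import Mathlib
import HarnessLib
import HarnessLib.Audit
import Summits.ValiantsHypothesis.Statement
import Literature.Computability.AlgebraicComplexity.CircuitDepth
import Literature.Computability.AlgebraicComplexity.StandardFamilies
import Literature.Computability.AlgebraicComplexity.ValiantClasses
import Literature.Computability.Complexity.ConstantDepthIMMProofs
import Summits.ValiantsHypothesis.ValiantsHypothesis.Theorems.DepthWindowDial
import HarnessLib.Audit.Status.Attr

/-!
Route: DecompCycle1B

CLOSED (superseded) 2026-08-29T18:45:17Z by planner-decomp-val-writer-1-g0-0 — reason: superseded:route-ValiantsHypothesis-DepthWindow — superseded by route-ValiantsHypothesis-DepthWindow — note: workshop writer: DecompCycle1B (opened 18:25:24Z) duplicates the lens-born route-ValiantsHypothesis-DepthWindow (lens-4, opened 18:21Z, commit ae884a35) — byte-identical statements, same four items 23549-23552 by signature dedup, same closes; per the critic's ruling on lens-5 (no writer copy when th. The file is kept as the record of this route; refuted decls are indexed as negative knowledge (`ledger negatives`).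

# Route DecompCycle1B — Decomposition workshop cycle 1, node B (DepthWindow) — per hard at
product-depth log log log n AND the collapse VP=VNP propagating down to that depth

WORKSHOP RECORD (decomp-valiant cycle 1 = VALIANT, writer decomp-val-writer-1-g0). This file is node
B of the OR over alternative
AND-decompositions of S = `ValiantsHypothesis`; node A is route DecompCycle1 (lens-6
TameSensitivity: S ⟺ PerNotTame ∧ TamePer), node C
is DecompCycle1C (lens-3 DeborderingSquare). Node B was proposed by decomp-val-lens-4 (NODE
2026-08-29T18:05:55Z; lens file
HOME/decomp-val-lens-4/DepthWindow.lean, reviewed @6afdb0db, final sha256 f0f07b7c…; Route.md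
2d6e4baf…, certified route.json 6b25f0e2…,
glue 81aa7e4f…) and CLEARED by the critic decomp-val-crit-1 at 2026-08-29T18:09:39Z
(HOME/CRITIC-LEDGER.md row 5: w1 S ⟹ A is
print-level modulo the binarisation lemma, w2 printed reach κ pinned, w3 lint) against the census
HOME/census/COSTUME-CENSUS-v1.json
(sha256 90724a8468526f3e…). Per-piece tags (critic): PerHardLog3 — WEAKER (S ⟹ A print-level via
gate-count normalisation; A ⟹ S
unknown) · leaf ATTACKABLE (typed sufficient rung S1 ImmLogHardLog3 + transport S2; proved-regime
rung from the kernel LST fact);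
CollapseLog3 — DECLARED-RESIDUAL(PerHardLog3) (kernel collapseLog3_iff_residual), WEAKER (vacuous
under S) · leaf IDEA-NEEDED;
CollapseClog — aside, PROVABLE-NOW (VSBR rung; documents that the top rung is summit-strength).
Statements, glue and sections below are
the lens's certified text, unchanged. LADDER-Valiant rung 0: nothing here proves VP ≠ VNP.

X = A ∧ B, the chasm read in the DUAL parametrisation (size fixed = poly(n), product-depth Δ(n)
varying), instantiated at
Δ₁(n) = ⌊log₂⌊log₂⌊log₂ n⌋⌋⌋ + 1. A = `PerHardLog3`: the permanent per_n ∈ ℂ[x_ij] has no family of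
unbounded-fan-in arithmetic
circuits of product-depth ≤ Δ₁(n) with n^c + c wires (in-tree `ArithCircuit`, edge count `edgeSize`
= LST's size measure, `productDepth`, `Computes`).
B = `CollapseLog3`: if VP_ℂ = VNP_ℂ then such a family exists. Both pieces are NECESSARY (VH ⇒ B
trivially, kernel-checked
`collapseToDepth_of_vh`; VH ⇒ A kernel-checked MODULO the single library lemma `BinarisationBound`
(a circuit with e wires
yields a fan-in-two circuit with ≤ 2e+2 gates): `perHardLog3_of_vh` in the lens file
DepthWindow.lean) and each is STRICTLY WEAKER than VH as far as anyone knows: A is implied by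
hardness of
IMM (a VP family) at depth Δ₁, a VP-internal depth-hierarchy statement orthogonal to VP vs VNP; B ⇒
VH would need A. Decomposition
workshop node (decomp-valiant cycle 1, lens 4); no idea card.
Lean: `(¬ ∃ c : ℕ, ∀ n : ℕ, ∃ C : Literature.Computability.AlgebraicComplexity.ArithCircuit ℂ (Fin n
× Fin n), C.Computes (Literature.Computability.AlgebraicComplexity.perPoly (Fin n) ℂ) ∧
C.productDepth ≤ Nat.log 2 (Nat.log 2 (Nat.log 2 n)) + 1 ∧ C.edgeSize ≤ n ^ c + c) ∧
(Literature.Computability.AlgebraicComplexity.VP ℂ =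
Literature.Computability.AlgebraicComplexity.VNP ℂ → ∃ c : ℕ, ∀ n : ℕ, ∃ C :
Literature.Computability.AlgebraicComplexity.ArithCircuit ℂ (Fin n × Fin n), C.Computes
(Literature.Computability.AlgebraicComplexity.perPoly (Fin n) ℂ) ∧ C.productDepth ≤ Nat.log 2
(Nat.log 2 (Nat.log 2 n)) + 1 ∧ C.edgeSize ≤ n ^ c + c)`

Rationale: WHY THIS LINE. For every depth function Δ the two-line assembly `A_Δ → B_Δ → VH` holds (modus
ponens: ¬VH gives VP=VNP, B_Δ gives the small circuits,
A_Δ refutes them). On the SIZE axis at fixed depth 4 (route-ValiantsHypothesis-Depth4;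
AgrawalVinay2008, Tavenas2015, KumarSaraf2017) the
reduction is a theorem, so the remaining piece is summit-strength and VP-saturated measures certify
a barrier
(Literature.Barriers.ValiantsHypothesis.DepthReductionChasmDepthFour). On the DEPTH axis the two
ends are theorems at DIFFERENT depths —
A_Δ for Δ ≤ ¼·log_φ log d with d = Θ(log n), i.e. Δ ≲ 0.36·log log log n
(LimayeSrinivasanTavenas2025 Cor. 4, IN TREE as
`Literature.Computability.Complexity.lst_constantDepth_imm_lower_bound_holds`;
BhargavDuttaSaxena2024 Thm 1.1/Rem 1.6), and B_Δ for
Δ ≥ ⌈log₂ n⌉ (ValiantSkyumBerkowitzRackoff1983 product-depth form, IN TREE as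
`DepthReduction.exists_computes_productDepth_le_clog`;
our Sketch proves `collapseToDepth_clog`) — so strictly inside the window BOTH pieces are open, both
necessary, neither known to carry the
summit; Δ₁ = log log log n + 1 is the lowest rung provably outside the reach of the relative-rank
method as printed (BhargavDuttaSaxena2024
Thm 1.7, LimayeSrinivasanTavenas2022 Thm 3) yet inside the reach the partial-derivative method is
not known to lack (tree-bias
d^{1/Δ^{O(log Δ)}} is not excluded). Imported area: none beyond algebraic complexity; the move is a
re-parametrisation of the chasm
(depth for size) that turns a one-open-piece split into a two-open-piece split. Nothing in the
negatives index concerns product-depth.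

RANKED CRUXES. #2 PerHardLog3 (crux) — A (ATTACKABLE leaf, WEAKER): for no constant c does every
per_n have an unbounded-fan-in arithmetic circuit over ℂ of product-depth ≤ ⌊log₂⌊log₂⌊log₂ n⌋⌋⌋ + 1
with at most n^c + c wires (edge size, the size measure of LST 2021 §2). Equivalently:
superpolynomial lower bound for the permanent at product-depth log log log n. Necessary for VH
(kernel modulo the binarisation lemma `BinarisationBound`, `perHardLog3_of_vh`); strictly weaker:
implied by hardness of IMM ∈ VP at that depth, not known to give VH. [difficulty: L] (why it might
fail: Known bounds die at Δ ≈ ¼·log_φ log d ≈ 0.36·logloglog n (BDS24 Rem 1.6) and the relative-rank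
measure is certified tight there (BDS24 Thm 1.7, LST22 Thm 3): at depth 1·logloglog n+1 a new
lopsided measure or escalation without depth doubling is needed.) [LimayeSrinivasanTavenas2025,
BhargavDuttaSaxena2024, LimayeSrinivasanTavenas2022, KushSaraf2022,
AmireddyGargKayalSahaThankey2023]
#3 CollapseLog3 (crux) — B (declared RESIDUAL, IDEA-NEEDED leaf, WEAKER/UNDECIDED-with-test): if
VP_ℂ = VNP_ℂ then for some c every per_n has an unbounded-fan-in circuit of product-depth ≤
⌊log₂⌊log₂⌊log₂ n⌋⌋⌋ + 1 with at most n^c + c wires — the collapse propagates from VSBR depth ⌈log₂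
n⌉ down to depth log log log n for the complete family. Necessary for VH (kernel, vacuous:
`collapseLog3_of_vh`); exactly the declared residual of PerHardLog3 (`collapseLog3_iff_residual :
CollapseLog3 ↔ (PerHardLog3 → VH)`, kernel); strictly weaker: with ¬VH it only yields poly-wire
depth-Δ₁ circuits for per, contradicting no theorem. [difficulty: open-problem] (why it might fail:
Unconditional depth reduction below Θ(log d) costs n^{Θ(d^{1/Δ})} and is tight for IMM at depth 3/4
(Tavenas2015, KumarSaraf2017, GKKS); B must consume VP=VNP (coefficient/exponential-sum closure,
Burgisser2000 Thm 2.10) in a way nobody has exhibited; false if VP=VNP yet IMM is hard at depth Δ₁.)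
[ValiantSkyumBerkowitzRackoff1983, Tavenas2015, KumarSaraf2017, Burgisser2000,
LimayeSrinivasanTavenas2025]
#9 CollapseClog (support) — VSBR rung (PROVABLE NOW; proof in the lens folder Sketch.lean
`collapseToDepth_clog_succ`): if VP_ℂ = VNP_ℂ then for some c every per_n has a circuit of
product-depth ≤ ⌈log₂ n⌉ + 1 with at most n^c + c wires. Documents that the top rung of the depth
ladder is summit-strength (A at depth ⌈log₂ n⌉+1 ⟹ VH) and that B is its strictly-lower-depth
analogue. [difficulty: provable-now] [ValiantSkyumBerkowitzRackoff1983, Burgisser2000]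

TWO-LAYER PLAN. PerHardLog3 ⇐ (S1) an LST-type lower bound n^{d^{μ'(Δ)}} for the IMM word
polynomials in the lopsided regime d = Θ(log n) with
d^{μ'(2Δ₁(n)+O(1))} = ω(1), i.e. μ' decaying slower than 1/F(Δ) (beating BDS24 Thm 1.4's Fibonacci
exponent, inside LST22's tree-bias
allowance) → (S2) escalation (LST Prop. 9, in tree `LowDepthRankBound`) + VNP-completeness transport
of circuits along the p-projection
IMM ≤_p per (`isVNPComplete_perPoly_holds`, `ArithCircuit.substVC` with
`size_substVC`/`productDepth_substVC`/`eval_substVC`).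
CollapseLog3 ⇐ (T1) VP=VNP → per in poly size at depth ⌊log₂⌊log₂ n⌋⌋+1 → (T2) VP=VNP → (depth
loglog ⇒ depth logloglog for per); rungs only.

KILL CRITERIA. Refuting PerHardLog3 (a uniform poly-size depth-logloglog construction for per_n —
would contradict nothing known but is believed
impossible) closes the route `refuted:PerHardLog3` and refutes VH-via-depth entirely. Refuting
CollapseLog3 requires VP = VNP together with
hardness of per at depth Δ₁, i.e. ¬VH: not expected; a proof that CollapseLog3 → VH (e.g. an
LST-type IMM lower bound reaching depth
log log log n + 1, which PROVES PerHardLog3) converts the route into "A proved, B summit-strength" —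
then re-instantiate one rung higher
(Δ = ⌊log₂⌊log₂ n⌋⌋ + 1) by the same template. Proved elsewhere that moots it: VH itself, or per ∈
VP (kills VH).

NOT DECOMPOSED YET. The measure for S1 (which lopsided word sizes / which rank variant), the exact
constant in Δ₁ versus the BDS reach (we use coefficient 1
on log log log n; BDS reach is ≈ 0.36, relative-rank ceiling ≈ 0.72 after depth doubling), the index
arithmetic of the p-projection
transport (t(m) ≤ m^a + a shifts Δ₁ by at most 1), and everything about CollapseLog3 (IDEA-NEEDED:
which consequence of VP = VNP could
shorten product-depth for the complete family — coefficient extraction, closure under exponential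
sums, or self-reducibility of per).

CHEAPEST FALSIFIER. For A: check whether BhargavDuttaSaxena2024 Rem 1.6 / Forbes 2024 (any field) or
a 2025–26 successor already reaches product-depth
c·log log d with c ≥ 2 for d = Θ(log N) — that would PROVE PerHardLog3 outright (good) and push the
node one rung up. Ran: lit search /
lit read of BDS24 p.4–5 (reach ¼·log_φ log d; barrier Thm 1.7), LST22 p.1 (no N^{Ω(d^{1/poly Δ})} by
tree bias), KS22 (set-multilinear
formulas only, NW polynomial): no such result found. For B: exhibit, under VP = VNP, ANY depth
saving below ⌈log₂ d⌉ for a complete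
family — none in print (lit search "depth reduction VP = VNP collapse product-depth": 0 relevant
hits).

NUMBERS. Pinned exponents (critic w2). LimayeSrinivasanTavenas2025 (J. ACM 72, Art. 26) Cor. 4 =
FOCS 2021 Thm 1: for product-depth
Δ, IMM_{n,d} with d = O(log n) needs size n^{d^{exp(−O(Δ))}} (set-multilinearisation, their Lemma
12, doubles product depth
Δ ↦ 2Δ); BhargavDuttaSaxena2024 Thm 1.1 [corpus:paper:doi-10-1145-3689957 p.4]: size ≥
n^{Ω(d^{μ(2Δ)}/Δ)}, μ(Δ) = 1/(F(Δ)−1),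
F(0)=1, F(1)=2 Fibonacci, valid for Δ ≤ ¼·log_φ log d (Rem 1.6, p.4); Thm 1.7 [p.5]: relative-rank
barrier — a measure-maximal
set-multilinear P_Δ with product-depth-Δ circuits of size n^{O(Δ γ d^{μ(Δ)})}. Hence the printed
superpolynomial range for
d = Θ(log n) is Δ ≤ κ·log₂log₂log₂ n with κ ∈ [0.36, 0.72] by every reading (¼·log_φ: 0.36; F =
2^{2Δ}: 0.5; F = φ^{2Δ}: 0.72);
every κ < 1 leaves Δ₁ = 1·⌊log₂log₂log₂ n⌋ + 1 open; should a printed κ ≥ 1 surface, the node moves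
to the pre-typed rung
Δ = ⌊log₂⌊log₂ n⌋⌋ + 1 (skeleton T1). Tree-bias allowance LimayeSrinivasanTavenas2022 Thm 3 / §1
item 3
[corpus:paper:url-627f06fde96a p.1]: no N^{Ω(d^{1/poly(Δ)})} from lopsided PD, but d^{1/Δ^{O(log
Δ)}} not excluded.
Chasm trade-off: size-s degree-d circuits → product-depth Δ, size s^{O(d^{1/Δ})} (AgrawalVinay2008,
Koiran, Tavenas2015; poly only for
Δ = Ω(log d)). LST/BDS reach: IMM_{n,d}, d = O(log n), product-depth Δ ≤ ¼ log_φ log d, size ≥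
n^{Ω(d^{μ(2Δ)}/Δ)}, μ(Δ) = 1/(F(Δ)−1),
F Fibonacci (BhargavDuttaSaxena2024 Thm 1.1, Rem 1.6). Relative-rank barrier: measure-maximal P_Δ
with depth-Δ circuits of size
n^{O(Δ γ d^{μ(Δ)})} (BDS24 Thm 1.7); tree-bias barrier: no N^{Ω(d^{1/poly(Δ)})} from lopsided PD
(LimayeSrinivasanTavenas2022 item 3).
Set-multilinear formulas: N^{Ω(d^{1/Δ}/Δ)} for Δ ≤ log N / log log N (KushSaraf2022 Thm 1, NW
polynomial ∈ VNP), tight against Tavenas.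
VSBR: product-depth ⌈log₂ d⌉, wires ≤ 9(4L(d+1)²+1)⁴(N+1)(d+1) (`DepthReduction.vsbrEdgeBound`, in
tree).

DEFINITION REQUESTS. None: all pieces are stated over in-tree `ArithCircuit`, `Computes`,
`productDepth`, `size`, `perPoly`, `VP`, `VNP`. Wanted later as a
Literature fact (not load-bearing here): gate-count normalisation (G3) `size ≤ poly ⇒ complexity ≤
poly` for circuits computing a
degree-d polynomial in characteristic 0 (LimayeSrinivasanTavenas2025 §2), which would make VH ⇒
PerHardLog3 kernel-checkable.

Novelty: Searches (2026-08-29): lit search "product-depth lower bounds algebraic circuits set-multilinear"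
(12 local docs: LST21/25, BDS24, KS22,
TLS22, AGKST22, CELS18, …); lit search "partial derivative method lopsided set-multilinear
polynomials tree bias" (1 local: LST22); lit
galaxy search "lopsided set-multilinear|tree bias|Bypassing Set-Multilinearization" --star all (16
rows, 1 relevant: FLST ECCC 2023/191);
lit read BDS24 pp.4–5, KS22 pp.2,5,11, LST22 p.1; lean search/rg in tree: CircuitDepth,
VSBRProductDepth, ConstantDepthIMM(Proofs),
Theses/Depth4, Barriers DepthReductionChasm*; ledger negatives (32, none on product-depth).
Nearest prior art found: route-ValiantsHypothesis-Depth4 (size axis at depth 4: reduction proved,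
residual Depth4HomFour ≥ VH);
LimayeSrinivasanTavenas2025 §1 / KushSaraf2022 §1 (remark that lower bounds at product-depth up to
o(log d)… would be needed for VP≠VNP
via the chasm); BhargavDuttaSaxena2024 (reach + barrier on the depth axis).
Delta: the AND-split at a depth STRICTLY INSIDE the window (both ends open), with the conditional
collapse-propagation piece B made
explicit and kernel-glued, so that neither piece is summit-strength — the size-axis routes and the
printed discussions only use the
window's endpoints, where one piece is a theorem and the other carries the summit.
Claimed grade: new-combination  [refs: LimayeSrinivasanTavenas2025, KushSaraf2022, BhargavDuttaSaxena2024]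

Barriers (technique_class: depth-reduction, partial-derivative-rank, lopsided-SML): - technique_class: depth-reduction, partial-derivative-rank, lopsided-SML
- Literature.Barriers.ValiantsHypothesis.DepthReductionChasmDepthFour: does not bite — it certifies
that VP-saturated measures cannot cross the SIZE threshold at depth 4 (where VP itself sits at the
threshold); PerHardLog3 lives at poly size and depth log log log n ≪ log n, where VP families (IMM)
are themselves believed hard, so a VP-saturated measure is no obstruction; the barrier reappears
exactly at the top rung Δ = Θ(log n), which this route does not use.
- Literature.Barriers.ValiantsHypothesis.DepthReductionChasm: same placement — HomVPSaturated
measures are excluded only at the chasm endpoint; our rung is interior.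
- Literature.Barriers.ValiantsHypothesis.DepthThreeChasmTight: bites CollapseLog3's UNCONDITIONAL
analogue (depth reduction below Θ(log d) at poly size is impossible in general, GKKS/KumarSaraf
tightness); evasion: B is stated under VP = VNP and for the complete family only — any proof must
consume the hypothesis (IDEA-NEEDED); it does not evade it unconditionally, the bet is that VP = VNP
is strong enough to collapse depth for per.
- Literature.Barriers.ValiantsHypothesis.AlgebraicNaturalProofs: partial-derivative-rank measures
are algebraically natural; the barrier (FSV18/CKRST20, conditional on succinct hitting sets for VP)
quantifies over lower bounds against VP, whereas PerHardLog3 is a lower bound against poly-size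
depth-log log log n circuits, a class not known to support succi

History (route lifecycle, newest last):
- 2026-08-29T18:45:17Z · CLOSED superseded — superseded:route-ValiantsHypothesis-DepthWindow (planner-decomp-val-writer-1-g0-0)

sub-problem: ValiantsHypothesis · status: closed(superseded) · opened planner-decomp-val-writer-1-g0-0 2026-08-29T18:24:59Z · rev 0 · ledger route-ValiantsHypothesis-DecompCycle1B
GENERATED by the gate from the ledger (D-0016/17). Provers cite these decls: `theorem foo : Summit.ValiantsHypothesis.ValiantsHypothesis.Theses.DecompCycle1B.<Decl> := …` in Summits/ValiantsHypothesis/ValiantsHypothesis/Theorems/<Name>.lean.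
-/

namespace Summit.ValiantsHypothesis.ValiantsHypothesis.Theses.DecompCycle1B

open scoped BigOperators Topology Manifold Classical MeasureTheory ProbabilityTheory Matrix InnerProductSpace ComplexConjugate ContinuousMap
open Filter Set Function TopologicalSpace MeasureTheory

attribute [summit_statement] _root_.ValiantsHypothesis

open Literature.PNP

/-- item stmt-ValiantsHypothesis-23549 · crux · rank 2 · open · by planner
why it might fail: Known bounds die at Δ ≈ ¼·log_φ log d ≈ 0.36·logloglog n (BDS24 Rem 1.6) and the relative-rank measure is certified tight there (BDS24 Thm 1.7, LST22 Thm 3): at depth 1·logloglog n+1 a new lopsided measure or escalation without depth doubling is needed.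
sources: LimayeSrinivasanTavenas2025, BhargavDuttaSaxena2024, LimayeSrinivasanTavenas2022, KushSaraf2022, AmireddyGargKayalSahaThankey2023
[crux] A (ATTACKABLE leaf, WEAKER): for no constant c does every per_n have an unbounded-fan-in
arithmetic circuit over ℂ of product-depth ≤ ⌊log₂⌊log₂⌊log₂ n⌋⌋⌋ + 1 with at most n^c + c wires
(edge size, the size measure of LST 2021 §2). Equivalently: superpolynomial lower bound for the
permanent at product-depth log log log n. Necessary for VH (kernel modulo the binarisation lemma
`BinarisationBound`, `perHardLog3_of_vh`); strictly weaker: implied by hardness of IMM ∈ VP at that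
depth, not known to give VH. [difficulty: L] -/
@[route_item "route-ValiantsHypothesis-DecompCycle1B", crux]
def PerHardLog3 : Prop :=
  ¬ ∃ c : ℕ, ∀ n : ℕ, ∃ C : Literature.Computability.AlgebraicComplexity.ArithCircuit ℂ (Fin n × Fin n), C.Computes (Literature.Computability.AlgebraicComplexity.perPoly (Fin n) ℂ) ∧ C.productDepth ≤ Nat.log 2 (Nat.log 2 (Nat.log 2 n)) + 1 ∧ C.edgeSize ≤ n ^ c + c

/-- item stmt-ValiantsHypothesis-23550 · crux · rank 3 · open · by planner
why it might fail: Unconditional depth reduction below Θ(log d) costs n^{Θ(d^{1/Δ})} and is tight for IMM at depth 3/4 (Tavenas2015, KumarSaraf2017, GKKS); B must consume VP=VNP (coefficient/exponential-sum closure, Burgisser2000 Thm 2.10) in a way nobody has exhibited; false if VP=VNP yet IMM is hard at depth Δ₁.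
sources: ValiantSkyumBerkowitzRackoff1983, Tavenas2015, KumarSaraf2017, Burgisser2000, LimayeSrinivasanTavenas2025
[crux] B (declared RESIDUAL, IDEA-NEEDED leaf, WEAKER/UNDECIDED-with-test): if VP_ℂ = VNP_ℂ then for
some c every per_n has an unbounded-fan-in circuit of product-depth ≤ ⌊log₂⌊log₂⌊log₂ n⌋⌋⌋ + 1 with
at most n^c + c wires — the collapse propagates from VSBR depth ⌈log₂ n⌉ down to depth log log log n
for the complete family. Necessary for VH (kernel, vacuous: `collapseLog3_of_vh`); exactly the
declared residual of PerHardLog3 (`collapseLog3_iff_residual : CollapseLog3 ↔ (PerHardLog3 → VH)`,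
kernel); strictly weaker: with ¬VH it only yields poly-wire depth-Δ₁ circuits for per, contradicting
no theorem. [difficulty: open-problem] -/
@[route_item "route-ValiantsHypothesis-DecompCycle1B", crux]
def CollapseLog3 : Prop :=
  Literature.Computability.AlgebraicComplexity.VP ℂ = Literature.Computability.AlgebraicComplexity.VNP ℂ → ∃ c : ℕ, ∀ n : ℕ, ∃ C : Literature.Computability.AlgebraicComplexity.ArithCircuit ℂ (Fin n × Fin n), C.Computes (Literature.Computability.AlgebraicComplexity.perPoly (Fin n) ℂ) ∧ C.productDepth ≤ Nat.log 2 (Nat.log 2 (Nat.log 2 n)) + 1 ∧ C.edgeSize ≤ n ^ c + c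

/-- item stmt-ValiantsHypothesis-23551 · aside · rank 9 · closed · proved by Summit.ValiantsHypothesis.ValiantsHypothesis.Theorems.DepthWindow.collapseClog_holds (planner) · by planner
sources: ValiantSkyumBerkowitzRackoff1983, Burgisser2000
[support] VSBR rung (PROVABLE NOW; proof in the lens folder Sketch.lean
`collapseToDepth_clog_succ`): if VP_ℂ = VNP_ℂ then for some c every per_n has a circuit of
product-depth ≤ ⌈log₂ n⌉ + 1 with at most n^c + c wires. Documents that the top rung of the depth
ladder is summit-strength (A at depth ⌈log₂ n⌉+1 ⟹ VH) and that B is its strictly-lower-depth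
analogue. [difficulty: provable-now] -/
@[route_item "route-ValiantsHypothesis-DecompCycle1B"]
def CollapseClog : Prop :=
  Literature.Computability.AlgebraicComplexity.VP ℂ = Literature.Computability.AlgebraicComplexity.VNP ℂ → ∃ c : ℕ, ∀ n : ℕ, ∃ C : Literature.Computability.AlgebraicComplexity.ArithCircuit ℂ (Fin n × Fin n), C.Computes (Literature.Computability.AlgebraicComplexity.perPoly (Fin n) ℂ) ∧ C.productDepth ≤ Nat.clog 2 n + 1 ∧ C.edgeSize ≤ n ^ c + c

/-- `CollapseClog` holds: proved by `Summit.ValiantsHypothesis.ValiantsHypothesis.Theorems.DepthWindow.collapseClog_holds`. -/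
theorem CollapseClog_holds : CollapseClog := _root_.Summit.ValiantsHypothesis.ValiantsHypothesis.Theorems.DepthWindow.collapseClog_holds

/-- item stmt-ValiantsHypothesis-23552 · assembly · rank 1 · open · by planner
sources: Burgisser2000
[assembly] PerHardLog3 → CollapseLog3 → VH: assume VP ℂ = VNP ℂ, get the poly-wire depth-Δ₁ circuits
for per from CollapseLog3, contradict PerHardLog3. The deciding theorem `closes` in glue.lean is
exactly this. [difficulty: provable-now] -/
@[route_item "route-ValiantsHypothesis-DecompCycle1B"]
def Assembly : Prop :=
  PerHardLog3 → CollapseLog3 → _root_.ValiantsHypothesis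

/-! D-0027 §2.1 — DECIDING THEOREM (planner-authored via `route open/edit --closes-file`; by planner-decomp-val-writer-1-g0-0 2026-08-29T18:24:59Z) — ARCHIVED: route closed (superseded) 2026-08-29T18:45:17Z; kept so importers keep building:
its hypotheses are this route's items and its conclusion the sub-problem Statement (glue_lint), and it elaborates with this file. -/

@[closes "route-ValiantsHypothesis-DecompCycle1B"] theorem closes (hA : PerHardLog3) (hB : CollapseLog3) : _root_.ValiantsHypothesis := by
  show Literature.Computability.AlgebraicComplexity.VP ℂ ≠ Literature.Computability.AlgebraicComplexity.VNP ℂ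
  intro hEq
  exact hA (hB hEq)

end Summit.ValiantsHypothesis.ValiantsHypothesis.Theses.DecompCycle1B
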